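import Mathlib.MeasureTheory.Function.ConvergenceInDistribution
import Literature.Probability.Percolation.FKLoopNestingGaussianGlue
import Literature.Probability.LatticeModels.SixVertexGFFInvariance
import Literature.Probability.LatticeModels.SixVertexGFFCorrelations
import HarnessLib

/-!
# DKLM 2026, Cor. 10 from Thm. 2.8: the test pairing is robust under `δ`-proportional shifts of
# the test function (reading the Baxter–Kelland–Wu identity with its half-lattice offset)

H. Duminil-Copin, K. K. Kozlowski, P. Lammers, I. Manolescu, *Gaussian free field convergence of
the six-vertex model with `-1 ≤ Δ ≤ -1/2`*, arXiv:2603.06268 (2026)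
[DuminilCopinKozlowskiLammersManolescu2026 = DKLM2026SixVertexGFF], §3.2 and Cor. 10 (held source
`paper:arxiv-2603.06268`, chunk p0013):

> The Baxter–Kelland–Wu (BKW) coupling implies the following identity for any test function `φ`:
> `E^{6V}_{δℤ²}[e^{i⟨h^{(δ)},φ⟩}] = φ_{δℤ²,q}[∏_{ℓ∈ℒ} cos_μ(φ(int(ℓ)))]` (3.2) […]
> **Corollary 10.** Fix `q ∈ [1,4]`. For every finite Dirichlet energy generalized test function
> `φ`, `lim_{δ→0} φ_{δℤ²,q}[∏_{ℓ} cos_μ(φ(int(ℓ)))] = exp(-½σ² ∬ G φ φ)`, `σ² = 2/arccos(-√q/2)`.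
> *[Proof:]* "The convergence to the Gaussian free field yields the following corollary."

`FKLoopNestingGaussianGlue` formalises this one-line proof modulo its two inputs — the tree's
Thm. 2.8 (`SixVertex.DKLM2026_sixVertex_heightFunction_GFF`, a named fact) and the BKW identity
(3.2) — as `tendsto_integral_loopNestingWeight_of_sixVertexGFF`, with (3.2) consumed for a FIXED
six-vertex-side density `ρ`. The BKW embedding, however, does not deliver (3.2) in that form: the
six-vertex lattice of the coupling is the medial lattice of the random-cluster lattice `δℤ²`
(loops of `bondLoopConfig δ 0 ω`), i.e. `δ · (((1+i)/2) ℤ² + i/2)`, whereas the height function of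
`SixVertexGFF` (`heightPlane`, faces with integer corners) lives on `ℤ²`; pulling the plane back
to six-vertex coordinates at mesh `δ` therefore translates the test function by `δ · o` with a
half-odd lattice vector `o ∈ (ℤ + ½)²`, which no automorphism of `ℤ²` removes (both lattice
measures are only `ℤ²`-invariant). Honest (3.2) thus reads
`E_{P₆}[exp(i⟨h^{(δ)}, ρ(· - δ o)⟩)] = E_P[∏_ℓ cos_μ(φ(int ℓ))]` with a `δ`-DEPENDENT density
`ρ(· - δ o)`, while Thm. 2.8 (2) is a statement about a fixed `ρ`.

This file closes that gap, using nothing beyond Thm. 2.8 itself (as a hypothesis): **mode (1)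
with `k = 2` makes the shift error negligible.** For `ρ` continuous with compact support and any
`s ∈ ℂ`,
`⟨h^{(δ)}, ρ(· - δs)⟩ - ⟨h^{(δ)}, ρ⟩ = ∫ (h(w/δ + s) - h(w/δ)) ρ(w) dw`, whose second moment is
`∬ Φ₂^{(δ)}((w, w+δs), (w', w'+δs)) ρ(w) ρ(w') dw dw'`; the increment correlation is bounded by
`(|re s| + |im s| + 2)²` (ice rule a.s., `1`-Lipschitz heights) and, for `w ≠ w'`, tends to `0`
by the uniform convergence `Φ₂^{(δ)} → σ²Ψ₂` on a compact neighbourhood in `𝒟₂` of the collapsed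
dipole pair together with `Ψ₂((w,w),(w',w')) = 0`; dominated convergence, Markov's inequality and
Slutsky's lemma (`MeasureTheory.tendstoInDistribution_of_tendstoInMeasure_sub`) then transfer the
limit law of `⟨h^{(δ)}, ρ⟩` (mode (2)) to the shifted pairings.

## Main results

* `testPairing_shift`, `testPairing_shift_sub`: the shifted pairing and the shift error as
  integrals against `ρ` (translation invariance of Lebesgue measure).
* `abs_heightPlane_add_sub_le`: `|h(z + s) - h(z)| ≤ |re s| + |im s| + 2` on ice configurations.
* `kPointScaled_two_dipoles`, `integral_sq_integral_heightIncrement_mul`: the second moment of the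
  shift error as a double integral of `Φ₂^{(δ)}` at dipole pairs (Fubini).
* `tendsto_gffKPoint_two_dipoles`, `tendsto_kPointScaled_two_dipoles`,
  `tendsto_integral_sq_shiftError`: the second moment tends to `0` (Thm. 2.8 (1), `k = 2`).
* `tendstoInMeasure_shiftError`, `tendsto_integral_comp_testPairing_shift`,
  `tendsto_integral_comp_testPairing_shift_of_GFF`: the shifted pairings have the same limit law
  (for every bounded continuous test `g`), in particular `N(0, σ²Σ(ρ))` under the named fact.
* `tendsto_integral_loopNestingWeight_of_sixVertexGFF_shift`: Cor. 10 for `(q, P, φ)` from the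
  named fact and the BKW identity stated for the shifted pairing `⟨h^{(δ)}, ρ(· - δs)⟩`.

## Faithfulness / status

Nothing here is a new hypothesis on the world: every statement is proved, the GFF input enters
only as the hypothesis `hX : SixVertex.DKLM2026_sixVertex_heightFunction_GFF` (Thm. 2.8) or as
its two modes spelled out, and the BKW identity (3.2) — deferred by the authors to their
companion paper and absent from the tree — remains the hypothesis `h32` of the final theorem, now
in the form the coupling produces. What is still not covered towards the named fact
`dklm2026_corollary10`: (3.2) itself in infinite volume, the existence of the planar six-vertex
measure (Thm. 2.2; the cylinder limit is `SixVertexCylinderLimit`), and test functions beyond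
`C_c` densities (Thm. 2.8 (2) is vendored for those only).

## References

* H. Duminil-Copin, K. K. Kozlowski, P. Lammers, I. Manolescu, arXiv:2603.06268 (2026): §3.2,
  (3.2), Thm. 8 = Thm. 2.8 with Def. 2.4–2.7, Cor. 10 and its proof (p. 13).
  [DuminilCopinKozlowskiLammersManolescu2026] [DKLM2026SixVertexGFF]
* R. J. Baxter, S. B. Kelland, F. Y. Wu, *Equivalence of the Potts model or Whitney polynomial
  with an ice-type model*, J. Phys. A 9 (1976) 397–406 (the coupling and its medial lattice).
-/

noncomputable section

open MeasureTheory Set Filter Complex ProbabilityTheory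
open scoped Real Topology NNReal BoundedContinuousFunction

namespace Literature.Probability.Percolation

open LatticeModels RandomPlanarGeometry

/-! ### The shifted pairing -/

/-- Pairing the scaled height function with a density translated by `δ·s` is pairing the height
function read `s` lattice units further with the original density:
`⟨h^{(δ)}, ρ(· - δs)⟩ = ∫ h(w/δ + s) ρ(w) dw` (translation invariance of Lebesgue measure).
[cite: DKLM2026SixVertexGFF, Def. 2.5] -/
theorem testPairing_shift (ω : SixVertex.Config (ℤ × ℤ)) {δ : ℝ} (hδ : δ ≠ 0) (ρ : ℂ → ℝ)
    (s : ℂ) :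
    SixVertex.testPairing ω δ (fun w ↦ ρ (w - δ * s)) =
      ∫ w, (SixVertex.heightPlane ω (w / δ + s) : ℝ) * ρ w := by
  have hδ' : (δ : ℂ) ≠ 0 := by exact_mod_cast hδ
  simp only [SixVertex.testPairing, SixVertex.heightScaled]
  refine ((integral_add_right_eq_self (μ := (volume : Measure ℂ))
    (fun w : ℂ ↦ (SixVertex.heightPlane ω (w / δ) : ℝ) * ρ (w - δ * s)) ((δ : ℂ) * s)).symm).trans ?_
  refine integral_congr_ae (ae_of_all _ fun w ↦ ?_)
  simp only [add_sub_cancel_right, add_div, mul_div_cancel_left₀ _ hδ']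

/-! ### Height differences over a bounded lattice displacement are bounded (ice configurations) -/

/-- `|⌊x + t⌋ - ⌊x⌋| ≤ |t| + 1`. [folklore] -/
theorem abs_floor_add_sub_floor_le (x t : ℝ) :
    |((⌊x + t⌋ : ℤ) : ℝ) - ((⌊x⌋ : ℤ) : ℝ)| ≤ |t| + 1 := by
  have h1 : ((⌊x + t⌋ : ℤ) : ℝ) ≤ x + t := Int.floor_le _
  have h2 : x + t < ((⌊x + t⌋ : ℤ) : ℝ) + 1 := Int.lt_floor_add_one _
  have h3 : ((⌊x⌋ : ℤ) : ℝ) ≤ x := Int.floor_le _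
  have h4 : x < ((⌊x⌋ : ℤ) : ℝ) + 1 := Int.lt_floor_add_one _
  rw [abs_le]
  constructor
  · have := neg_abs_le t
    linarith
  · have := le_abs_self t
    linarith

/-- For an ice configuration, reading the height `s` further changes it by at most
`|re s| + |im s| + 2` (the height function is `1`-Lipschitz along lattice paths,
`SixVertex.heightAt_sub_heightAt`). [cite: DKLM2026SixVertexGFF, Def. 2.3] -/
theorem abs_heightPlane_add_sub_le (ω : SixVertex.Config (ℤ × ℤ))
    (hice : ∀ v, SixVertex.IceRuleAt ω v) (z s : ℂ) :
    |((SixVertex.heightPlane ω (z + s) : ℝ) - (SixVertex.heightPlane ω z : ℝ))| ≤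
      |s.re| + |s.im| + 2 := by
  unfold SixVertex.heightPlane
  rw [Complex.add_re, Complex.add_im]
  have h := SixVertex.heightAt_sub_heightAt ω hice (⌊z.re⌋, ⌊z.im⌋) (⌊z.re + s.re⌋, ⌊z.im + s.im⌋)
  have hE := SixVertex.abs_zsumIco_le (fun x ↦ SixVertex.eastStep ω x ⌊z.im⌋)
    (fun k ↦ SixVertex.abs_eastStep_le ω k _) ⌊z.re⌋ ⌊z.re + s.re⌋
  have hN := SixVertex.abs_zsumIco_le (fun y ↦ SixVertex.northStep ω ⌊z.re + s.re⌋ y)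
    (fun k ↦ SixVertex.abs_northStep_le ω _ k) ⌊z.im⌋ ⌊z.im + s.im⌋
  have hre := abs_floor_add_sub_floor_le z.re s.re
  have him := abs_floor_add_sub_floor_le z.im s.im
  dsimp only at h
  have hcast : ((SixVertex.heightAt ω (⌊z.re + s.re⌋, ⌊z.im + s.im⌋) : ℤ) : ℝ) -
      ((SixVertex.heightAt ω (⌊z.re⌋, ⌊z.im⌋) : ℤ) : ℝ) =
      ((SixVertex.zsumIco (fun x ↦ SixVertex.eastStep ω x ⌊z.im⌋) ⌊z.re⌋ ⌊z.re + s.re⌋ : ℤ) : ℝ) +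
        ((SixVertex.zsumIco (fun y ↦ SixVertex.northStep ω ⌊z.re + s.re⌋ y) ⌊z.im⌋ ⌊z.im + s.im⌋ :
          ℤ) : ℝ) := by
    exact_mod_cast h
  have hE' : |((SixVertex.zsumIco (fun x ↦ SixVertex.eastStep ω x ⌊z.im⌋) ⌊z.re⌋ ⌊z.re + s.re⌋ :
      ℤ) : ℝ)| ≤ |s.re| + 1 := by
    refine le_trans ?_ hre
    exact_mod_cast hE
  have hN' : |((SixVertex.zsumIco (fun y ↦ SixVertex.northStep ω ⌊z.re + s.re⌋ y) ⌊z.im⌋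
      ⌊z.im + s.im⌋ : ℤ) : ℝ)| ≤ |s.im| + 1 := by
    refine le_trans ?_ him
    exact_mod_cast hN
  rw [hcast]
  calc _ ≤ _ := abs_add_le _ _
    _ ≤ (|s.re| + 1) + (|s.im| + 1) := add_le_add hE' hN'
    _ = |s.re| + |s.im| + 2 := by ring

/-! ### Joint measurability of the height function -/

/-- `(ω, z) ↦ h_ω(z)` is jointly measurable (a measurable function of `ω` and of the lattice face
containing `z`). [folklore] -/
theorem measurable_heightPlane_uncurry :
    Measurable fun p : SixVertex.Config (ℤ × ℤ) × ℂ ↦ (SixVertex.heightPlane p.1 p.2 : ℝ) := by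
  have hg : Measurable fun q : SixVertex.Config (ℤ × ℤ) × (ℤ × ℤ) ↦ SixVertex.heightAt q.1 q.2 := by
    refine measurable_from_prod_countable_left fun m ↦ ?_
    exact SixVertex.measurable_heightAt m
  have hh : Measurable fun p : SixVertex.Config (ℤ × ℤ) × ℂ ↦ (p.1, (⌊p.2.re⌋, ⌊p.2.im⌋)) :=
    measurable_fst.prodMk
      ((Int.measurable_floor.comp (Complex.measurable_re.comp measurable_snd)).prodMk
        (Int.measurable_floor.comp (Complex.measurable_im.comp measurable_snd)))
  have hZ : Measurable fun p : SixVertex.Config (ℤ × ℤ) × ℂ ↦ SixVertex.heightPlane p.1 p.2 := by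
    have h := hg.comp hh
    exact h
  exact (measurable_of_countable (Int.cast : ℤ → ℝ)).comp hZ

/-- The height increment over `s` lattice units, read at `w/δ`, is jointly measurable in
`(ω, w)`. [folklore] -/
theorem measurable_heightIncrement (δ : ℝ) (s : ℂ) :
    Measurable fun p : SixVertex.Config (ℤ × ℤ) × ℂ ↦
      ((SixVertex.heightPlane p.1 (p.2 / δ + s) : ℝ) - (SixVertex.heightPlane p.1 (p.2 / δ) : ℝ)) := by
  have ha : Measurable fun p : SixVertex.Config (ℤ × ℤ) × ℂ ↦ (p.1, p.2 / (δ : ℂ) + s) :=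
    measurable_fst.prodMk ((measurable_snd.div_const _).add_const _)
  have hb : Measurable fun p : SixVertex.Config (ℤ × ℤ) × ℂ ↦ (p.1, p.2 / (δ : ℂ)) :=
    measurable_fst.prodMk (measurable_snd.div_const _)
  have h1 := measurable_heightPlane_uncurry.comp ha
  have h2 := measurable_heightPlane_uncurry.comp hb
  exact h1.sub h2

/-! ### The increment correlation is the scaled two-point function at a pair of dipoles -/

/-- The scaled two-point function at the pair of `δ`-dipoles `(w, w + δs)`, `(w', w' + δs)` is the
correlation of the two height increments over `s` lattice units read at `w/δ` and `w'/δ`.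
[cite: DKLM2026SixVertexGFF, Def. 2.4] -/
theorem kPointScaled_two_dipoles (P₆ : Measure (SixVertex.Config (ℤ × ℤ))) {δ : ℝ} (hδ : δ ≠ 0)
    (s w w' : ℂ) :
    SixVertex.kPointScaled P₆ 2 δ ![(w, w + δ * s), (w', w' + δ * s)] =
      ∫ ω, ((SixVertex.heightPlane ω (w / δ + s) : ℝ) - SixVertex.heightPlane ω (w / δ)) *
        ((SixVertex.heightPlane ω (w' / δ + s) : ℝ) - SixVertex.heightPlane ω (w' / δ)) ∂P₆ := by
  unfold SixVertex.kPointScaled SixVertex.kPoint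
  refine integral_congr_ae (ae_of_all _ fun ω ↦ ?_)
  have hδ' : (δ : ℂ) ≠ 0 := by exact_mod_cast hδ
  simp only [Fin.prod_univ_two, Matrix.cons_val_zero, Matrix.cons_val_one,
    add_div, mul_div_cancel_left₀ _ hδ']

/-! ### Pointwise bounds -/

/-- A crude global bound `|h_ω(z)| ≤ 2 (‖z‖ + 1)` (the height vanishes at the origin face and is
`1`-Lipschitz along the defining lattice path). [folklore] -/
theorem abs_heightPlane_le_norm (ω : SixVertex.Config (ℤ × ℤ)) (z : ℂ) :
    |(SixVertex.heightPlane ω z : ℝ)| ≤ 2 * (‖z‖ + 1) := by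
  have h := SixVertex.abs_heightPlane_le ω z
  -- `|⌊x⌋| ≤ |x| + 1` (also in the tree as `PeriodPair.abs_int_floor_le`, not imported here)
  have hfloor : ∀ x : ℝ, |((⌊x⌋ : ℤ) : ℝ)| ≤ |x| + 1 := by
    intro x
    have h1 : ((⌊x⌋ : ℤ) : ℝ) ≤ x := Int.floor_le _
    have h2 : x < ((⌊x⌋ : ℤ) : ℝ) + 1 := Int.lt_floor_add_one _
    rw [abs_le]
    constructor
    · have := neg_abs_le x
      linarith
    · have := le_abs_self x
      linarith
  have hre := hfloor z.re
  have him := hfloor z.im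
  have h1 : |z.re| ≤ ‖z‖ := Complex.abs_re_le_norm z
  have h2 : |z.im| ≤ ‖z‖ := Complex.abs_im_le_norm z
  linarith

/-- `w ↦ h_ω(w/δ + t) ρ(w)` is integrable for `ρ` continuous with compact support (it is
measurable, and dominated by the continuous compactly supported `2(‖w/δ + t‖ + 1)‖ρ(w)‖`).
[folklore] -/
theorem integrable_heightPlane_mul (ω : SixVertex.Config (ℤ × ℤ)) (δ : ℝ) (t : ℂ) {ρ : ℂ → ℝ}
    (hρc : Continuous ρ) (hρs : HasCompactSupport ρ) :
    Integrable fun w : ℂ ↦ (SixVertex.heightPlane ω (w / δ + t) : ℝ) * ρ w := by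
  have hg : Continuous fun w : ℂ ↦ 2 * (‖w / δ + t‖ + 1) * ‖ρ w‖ := by fun_prop
  have hgs : HasCompactSupport fun w : ℂ ↦ 2 * (‖w / δ + t‖ + 1) * ‖ρ w‖ := by
    refine hρs.mono ?_
    intro w hw
    rw [Function.mem_support] at hw ⊢
    intro h0
    exact hw (by rw [h0, norm_zero, mul_zero])
  have ha : Measurable fun w : ℂ ↦ ((ω, w / (δ : ℂ) + t) : SixVertex.Config (ℤ × ℤ) × ℂ) :=
    measurable_const.prodMk ((measurable_id.div_const _).add_const _)
  have hb := measurable_heightPlane_uncurry.comp ha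
  have hmeas : Measurable fun w : ℂ ↦ (SixVertex.heightPlane ω (w / δ + t) : ℝ) * ρ w :=
    hb.mul hρc.measurable
  refine Integrable.mono' (hg.integrable_of_hasCompactSupport hgs) hmeas.aestronglyMeasurable
    (ae_of_all _ fun w ↦ ?_)
  simp only [Real.norm_eq_abs, abs_mul]
  exact mul_le_mul_of_nonneg_right (abs_heightPlane_le_norm ω _) (abs_nonneg _)

/-- **The shift error as one integral**: for `δ ≠ 0`,
`⟨h^{(δ)}, ρ(· - δs)⟩ - ⟨h^{(δ)}, ρ⟩ = ∫ (h(w/δ + s) - h(w/δ)) ρ(w) dw`.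
[cite: DKLM2026SixVertexGFF, Def. 2.5] -/
theorem testPairing_shift_sub (ω : SixVertex.Config (ℤ × ℤ)) {δ : ℝ} (hδ : δ ≠ 0) {ρ : ℂ → ℝ}
    (hρc : Continuous ρ) (hρs : HasCompactSupport ρ) (s : ℂ) :
    SixVertex.testPairing ω δ (fun w ↦ ρ (w - δ * s)) - SixVertex.testPairing ω δ ρ =
      ∫ w, ((SixVertex.heightPlane ω (w / δ + s) : ℝ) - SixVertex.heightPlane ω (w / δ)) * ρ w := by
  rw [testPairing_shift ω hδ ρ s]
  simp only [SixVertex.testPairing, SixVertex.heightScaled]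
  have h1 := integrable_heightPlane_mul ω δ s hρc hρs
  have h0 := integrable_heightPlane_mul ω δ 0 hρc hρs
  simp only [add_zero] at h0
  rw [← integral_sub h1 h0]
  refine integral_congr_ae (ae_of_all _ fun w ↦ ?_)
  ring

/-- On an ice configuration the height increment over `s` lattice units is bounded by
`|re s| + |im s| + 2`, wherever it is read. [cite: DKLM2026SixVertexGFF, Def. 2.3] -/
theorem abs_heightIncrement_le (ω : SixVertex.Config (ℤ × ℤ)) (hice : ∀ v, SixVertex.IceRuleAt ω v)
    (δ : ℝ) (s w : ℂ) :
    |((SixVertex.heightPlane ω (w / δ + s) : ℝ) - SixVertex.heightPlane ω (w / δ))| ≤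
      |s.re| + |s.im| + 2 :=
  abs_heightPlane_add_sub_le ω hice _ s

/-- On an ice configuration the shift error is at most `(|re s| + |im s| + 2) ‖ρ‖₁`.
[cite: DKLM2026SixVertexGFF, Def. 2.3 and Def. 2.5] -/
theorem abs_integral_heightIncrement_mul_le (ω : SixVertex.Config (ℤ × ℤ))
    (hice : ∀ v, SixVertex.IceRuleAt ω v) (δ : ℝ) (s : ℂ) {ρ : ℂ → ℝ} (hρi : Integrable ρ) :
    |∫ w, ((SixVertex.heightPlane ω (w / δ + s) : ℝ) - SixVertex.heightPlane ω (w / δ)) * ρ w| ≤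
      (|s.re| + |s.im| + 2) * ∫ w, |ρ w| := by
  rw [← Real.norm_eq_abs, ← integral_const_mul]
  refine norm_integral_le_of_norm_le (hρi.abs.const_mul _) (ae_of_all _ fun w ↦ ?_)
  rw [Real.norm_eq_abs, abs_mul]
  exact mul_le_mul_of_nonneg_right (abs_heightIncrement_le ω hice δ s w) (abs_nonneg _)

/-! ### The second moment of the shift error -/

section SecondMoment

variable {a b c : ℝ} {P₆ : Measure (SixVertex.Config (ℤ × ℤ))}

/-- The correlation of two height increments is bounded by `(|re s| + |im s| + 2)²` under any
planar six-vertex measure (the ice rule holds almost surely,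
`IsPlanarSixVertexMeasure.ae_iceRuleAt`). [cite: DKLM2026SixVertexGFF, Def. 2.4] -/
theorem abs_integral_heightIncrement_mul_heightIncrement_le
    (hP₆ : SixVertex.IsPlanarSixVertexMeasure a b c P₆) (δ : ℝ) (s w w' : ℂ) :
    |∫ ω, ((SixVertex.heightPlane ω (w / δ + s) : ℝ) - SixVertex.heightPlane ω (w / δ)) *
        ((SixVertex.heightPlane ω (w' / δ + s) : ℝ) - SixVertex.heightPlane ω (w' / δ)) ∂P₆| ≤
      (|s.re| + |s.im| + 2) ^ 2 := by
  haveI : IsProbabilityMeasure P₆ := hP₆.1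
  rw [← Real.norm_eq_abs]
  refine (norm_integral_le_of_norm_le_const (C := (|s.re| + |s.im| + 2) ^ 2) ?_).trans_eq
    (by simp)
  filter_upwards [hP₆.ae_iceRuleAt] with ω hω
  rw [Real.norm_eq_abs, abs_mul, sq]
  exact mul_le_mul (abs_heightIncrement_le ω hω δ s w) (abs_heightIncrement_le ω hω δ s w')
    (abs_nonneg _) (by positivity)

/-- **Second moment of the shift error as a double integral of increment correlations**:
`E_{P₆}[(∫ (h(w/δ+s) - h(w/δ)) ρ(w) dw)²] = ∬ E_{P₆}[Δ_s h(w/δ) Δ_s h(w'/δ)] ρ(w) ρ(w') dw dw'`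
(Fubini; the integrand is dominated by `(|re s|+|im s|+2)² |ρ(w)| |ρ(w')|` almost surely).
[cite: DKLM2026SixVertexGFF, Def. 2.4 and Def. 2.5] -/
theorem integral_sq_integral_heightIncrement_mul
    (hP₆ : SixVertex.IsPlanarSixVertexMeasure a b c P₆) (δ : ℝ) (s : ℂ) {ρ : ℂ → ℝ}
    (hρc : Continuous ρ) (hρs : HasCompactSupport ρ) :
    ∫ ω, (∫ w, ((SixVertex.heightPlane ω (w / δ + s) : ℝ) - SixVertex.heightPlane ω (w / δ)) * ρ w) ^ 2
        ∂P₆ =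
      ∫ p : ℂ × ℂ, (∫ ω, ((SixVertex.heightPlane ω (p.1 / δ + s) : ℝ) - SixVertex.heightPlane ω (p.1 / δ)) *
          ((SixVertex.heightPlane ω (p.2 / δ + s) : ℝ) - SixVertex.heightPlane ω (p.2 / δ)) ∂P₆) *
        (ρ p.1 * ρ p.2) ∂((volume : Measure ℂ).prod (volume : Measure ℂ)) := by
  haveI : IsProbabilityMeasure P₆ := hP₆.1
  have hρi : Integrable ρ := hρc.integrable_of_hasCompactSupport hρs
  -- the integrand on `Ω × (ℂ × ℂ)`
  set F : SixVertex.Config (ℤ × ℤ) → ℂ × ℂ → ℝ := fun ω p ↦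
    (((SixVertex.heightPlane ω (p.1 / δ + s) : ℝ) - SixVertex.heightPlane ω (p.1 / δ)) * ρ p.1) *
      (((SixVertex.heightPlane ω (p.2 / δ + s) : ℝ) - SixVertex.heightPlane ω (p.2 / δ)) * ρ p.2)
    with hF
  have hFm : Measurable (Function.uncurry F) := by
    have hq1 : Measurable fun q : SixVertex.Config (ℤ × ℤ) × (ℂ × ℂ) ↦ (q.1, q.2.1) :=
      measurable_fst.prodMk (measurable_fst.comp measurable_snd)
    have hq2 : Measurable fun q : SixVertex.Config (ℤ × ℤ) × (ℂ × ℂ) ↦ (q.1, q.2.2) :=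
      measurable_fst.prodMk (measurable_snd.comp measurable_snd)
    have h1 := (measurable_heightIncrement δ s).comp hq1
    have h2 := (measurable_heightIncrement δ s).comp hq2
    have hr1 : Measurable fun q : SixVertex.Config (ℤ × ℤ) × (ℂ × ℂ) ↦ ρ q.2.1 :=
      hρc.measurable.comp (measurable_fst.comp measurable_snd)
    have hr2 : Measurable fun q : SixVertex.Config (ℤ × ℤ) × (ℂ × ℂ) ↦ ρ q.2.2 :=
      hρc.measurable.comp (measurable_snd.comp measurable_snd)
    exact (h1.mul hr1).mul (h2.mul hr2)
  have hFi : Integrable (Function.uncurry F) (P₆.prod ((volume : Measure ℂ).prod (volume : Measure ℂ))) := by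
    have hbound : Integrable (fun q : SixVertex.Config (ℤ × ℤ) × (ℂ × ℂ) ↦
        (|s.re| + |s.im| + 2) ^ 2 * (|ρ q.2.1| * |ρ q.2.2|))
        (P₆.prod ((volume : Measure ℂ).prod (volume : Measure ℂ))) := by
      have h2 : Integrable (fun p : ℂ × ℂ ↦ |ρ p.1| * |ρ p.2|) ((volume : Measure ℂ).prod (volume : Measure ℂ)) :=
        hρi.abs.mul_prod hρi.abs
      exact (integrable_const ((|s.re| + |s.im| + 2) ^ 2) (μ := P₆)).mul_prod h2
    refine Integrable.mono' hbound hFm.aestronglyMeasurable ?_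
    have hae : ∀ᵐ q ∂(P₆.prod ((volume : Measure ℂ).prod (volume : Measure ℂ))),
        ∀ v, SixVertex.IceRuleAt q.1 v :=
      (Measure.quasiMeasurePreserving_fst (μ := P₆) (ν := (volume : Measure ℂ).prod (volume : Measure ℂ))).ae
        (p := fun ω ↦ ∀ v, SixVertex.IceRuleAt ω v) hP₆.ae_iceRuleAt
    filter_upwards [hae] with q hq
    change ‖F q.1 q.2‖ ≤ _
    rw [hF]
    dsimp only
    rw [Real.norm_eq_abs, abs_mul, abs_mul, abs_mul, sq]
    have hb1 := abs_heightIncrement_le q.1 hq δ s q.2.1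
    have hb2 := abs_heightIncrement_le q.1 hq δ s q.2.2
    calc _ ≤ ((|s.re| + |s.im| + 2) * |ρ q.2.1|) * ((|s.re| + |s.im| + 2) * |ρ q.2.2|) :=
        mul_le_mul (mul_le_mul_of_nonneg_right hb1 (abs_nonneg _))
          (mul_le_mul_of_nonneg_right hb2 (abs_nonneg _)) (by positivity) (by positivity)
      _ = _ := by ring
  -- Step 1: the square of the integral is a double integral
  have hsq : ∀ ω, (∫ w, ((SixVertex.heightPlane ω (w / δ + s) : ℝ) - SixVertex.heightPlane ω (w / δ)) * ρ w) ^ 2 =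
      ∫ p : ℂ × ℂ, F ω p ∂((volume : Measure ℂ).prod (volume : Measure ℂ)) := by
    intro ω
    rw [sq]
    exact (integral_prod_mul (μ := (volume : Measure ℂ)) (ν := (volume : Measure ℂ))
      (fun w ↦ ((SixVertex.heightPlane ω (w / δ + s) : ℝ) - SixVertex.heightPlane ω (w / δ)) * ρ w)
      (fun w ↦ ((SixVertex.heightPlane ω (w / δ + s) : ℝ) - SixVertex.heightPlane ω (w / δ)) * ρ w)).symm
  simp_rw [hsq]
  -- Step 2: Fubini
  rw [integral_integral_swap hFi]
  refine integral_congr_ae (ae_of_all _ fun p ↦ ?_)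
  beta_reduce
  rw [← integral_mul_const]
  refine integral_congr_ae (ae_of_all _ fun ω ↦ ?_)
  simp only [hF]
  ring

end SecondMoment

/-! ### The increment correlations vanish in the limit off the diagonal (Thm. 2.8, mode (1), k = 2) -/

section Limit

variable {a b c : ℝ} {P₆ : Measure (SixVertex.Config (ℤ × ℤ))}

/-- `Ψ₂^{GFF}` at the pair of `δ`-dipoles `(w, w+δs)`, `(w', w'+δs)` tends to `0` with `δ` when
`w ≠ w'`: it equals `2G(w,w') - G(w, w'+δs) - G(w+δs, w')` and `G` is continuous off the diagonal.
[cite: DKLM2026SixVertexGFF, Def. 2.6] -/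
theorem tendsto_gffKPoint_two_dipoles (s : ℂ) {w w' : ℂ} (hww' : w ≠ w') :
    Tendsto (fun δ : ℝ ↦ SixVertex.gffKPoint 2 ![(w, w + δ * s), (w', w' + δ * s)]) (𝓝 0) (𝓝 0) := by
  -- the Green function is continuous in each variable off the diagonal
  have hG : ∀ x y : ℂ, x ≠ y →
      Tendsto (fun δ : ℝ ↦ SixVertex.greenPlane x (y + δ * s)) (𝓝 0) (𝓝 (SixVertex.greenPlane x y)) := by
    intro x y hxy
    have hxy' : ‖y - x‖ ≠ 0 := norm_ne_zero_iff.2 (sub_ne_zero.2 (Ne.symm hxy))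
    unfold SixVertex.greenPlane
    refine Tendsto.const_mul _ ((Real.continuousAt_log hxy').tendsto.comp ?_)
    have hc : Continuous fun δ : ℝ ↦ ‖y + (δ : ℂ) * s - x‖ := by fun_prop
    have := hc.tendsto 0
    simpa using this
  have hG' : ∀ x y : ℂ, x ≠ y →
      Tendsto (fun δ : ℝ ↦ SixVertex.greenPlane (x + δ * s) y) (𝓝 0) (𝓝 (SixVertex.greenPlane x y)) := by
    intro x y hxy
    have hxy' : ‖y - x‖ ≠ 0 := norm_ne_zero_iff.2 (sub_ne_zero.2 (Ne.symm hxy))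
    unfold SixVertex.greenPlane
    refine Tendsto.const_mul _ ((Real.continuousAt_log hxy').tendsto.comp ?_)
    have hc : Continuous fun δ : ℝ ↦ ‖y - (x + (δ : ℂ) * s)‖ := by fun_prop
    have := hc.tendsto 0
    simpa using this
  have hconst : ∀ δ : ℝ, SixVertex.greenPlane (w + δ * s) (w' + δ * s) = SixVertex.greenPlane w w' := by
    intro δ
    unfold SixVertex.greenPlane
    rw [show w' + (δ : ℂ) * s - (w + (δ : ℂ) * s) = w' - w by ring]
  have key : ∀ δ : ℝ, SixVertex.gffKPoint 2 ![(w, w + δ * s), (w', w' + δ * s)] =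
      SixVertex.greenPlane w w' - SixVertex.greenPlane w (w' + δ * s) -
        SixVertex.greenPlane (w + δ * s) w' + SixVertex.greenPlane w w' := by
    intro δ
    rw [SixVertex.gffKPoint_two]
    simp only [Matrix.cons_val_zero, Matrix.cons_val_one]
    rw [hconst]
  simp_rw [key]
  have h := (((tendsto_const_nhds (x := SixVertex.greenPlane w w') (f := (𝓝 (0 : ℝ)))).sub
    (hG w w' hww')).sub (hG' w w' hww')).add
    (tendsto_const_nhds (x := SixVertex.greenPlane w w') (f := (𝓝 (0 : ℝ))))
  have h0 : SixVertex.greenPlane w w' - SixVertex.greenPlane w w' - SixVertex.greenPlane w w' +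
      SixVertex.greenPlane w w' = 0 := by ring
  rw [h0] at h
  exact h

/-- The product of "dipoles anchored at `w`, `w'` with heads within `‖w - w'‖/3`" lies in `𝒟₂`
when `w ≠ w'` (it is the compact set on which Thm. 2.8 (1) is read uniformly along
`δ ↦ ((w, w+δs), (w', w'+δs))`). [cite: DKLM2026SixVertexGFF, Def. 2.6 (𝒟_k)] -/
theorem pi_dipoles_subset_pairDomain {w w' : ℂ} (hww' : w ≠ w') :
    Set.pi Set.univ ![({w} : Set ℂ) ×ˢ Metric.closedBall w (‖w - w'‖ / 3),
        ({w'} : Set ℂ) ×ˢ Metric.closedBall w' (‖w - w'‖ / 3)] ⊆ SixVertex.pairDomain 2 := by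
  intro v hv
  have hr : (0 : ℝ) < ‖w - w'‖ := norm_pos_iff.2 (sub_ne_zero.2 hww')
  rw [Set.mem_univ_pi, Fin.forall_fin_two] at hv
  obtain ⟨h0, h1⟩ := hv
  simp only [Matrix.cons_val_zero, Matrix.cons_val_one, Set.mem_prod,
    Set.mem_singleton_iff, Metric.mem_closedBall, dist_eq_norm] at h0 h1
  obtain ⟨h0a, h0b⟩ := h0
  obtain ⟨h1a, h1b⟩ := h1
  -- points near `w` and points near `w'` are distinct
  have hne : ∀ x y : ℂ, ‖x - w‖ ≤ ‖w - w'‖ / 3 → ‖y - w'‖ ≤ ‖w - w'‖ / 3 → x ≠ y := by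
    intro x y hx hy hxy
    subst hxy
    have : ‖w - w'‖ ≤ ‖x - w‖ + ‖x - w'‖ := by
      calc ‖w - w'‖ = ‖(x - w') - (x - w)‖ := by congr 1; abel
        _ ≤ ‖x - w'‖ + ‖x - w‖ := norm_sub_le _ _
        _ = _ := add_comm _ _
    linarith
  have hww : ‖w - w‖ ≤ ‖w - w'‖ / 3 := by rw [sub_self, norm_zero]; positivity
  have hw'w' : ‖w' - w'‖ ≤ ‖w - w'‖ / 3 := by rw [sub_self, norm_zero]; positivity
  have key : Disjoint ({(v 0).1, (v 0).2} : Set ℂ) {(v 1).1, (v 1).2} := by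
    simp only [Set.disjoint_insert_left, Set.disjoint_singleton_left, Set.mem_insert_iff,
      Set.mem_singleton_iff, not_or]
    rw [h0a, h1a]
    exact ⟨⟨hne w w' hww hw'w', hne w _ hww h1b⟩, ⟨hne _ w' h0b hw'w', hne _ _ h0b h1b⟩⟩
  intro i j hij
  fin_cases i <;> fin_cases j
  · exact absurd rfl hij
  · simpa using key
  · simpa using key.symm
  · exact absurd rfl hij

/-- **The increment correlations vanish off the diagonal.** If the scaled two-point functions of
`P₆` converge to `C · Ψ₂^{GFF}` uniformly on compact subsets of `𝒟₂` (Thm. 2.8, mode (1), `k = 2`),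
then for `w ≠ w'` the correlation `E_{P₆}[Δ_s h(w/δ) Δ_s h(w'/δ)] = Φ₂^{(δ)}((w,w+δs),(w',w'+δs))`
tends to `0` as `δ → 0⁺`. [cite: DKLM2026SixVertexGFF, Thm. 2.8 (1) with Def. 2.4, 2.6] -/
theorem tendsto_kPointScaled_two_dipoles {C : ℝ}
    (h1 : ∀ K ⊆ SixVertex.pairDomain 2, IsCompact K →
      TendstoUniformlyOn (fun δ u ↦ SixVertex.kPointScaled P₆ 2 δ u)
        (fun u ↦ C * SixVertex.gffKPoint 2 u) (𝓝[>] (0 : ℝ)) K)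
    (s : ℂ) {w w' : ℂ} (hww' : w ≠ w') :
    Tendsto (fun δ : ℝ ↦ SixVertex.kPointScaled P₆ 2 δ ![(w, w + δ * s), (w', w' + δ * s)])
      (𝓝[>] 0) (𝓝 0) := by
  have hr : (0 : ℝ) < ‖w - w'‖ := norm_pos_iff.2 (sub_ne_zero.2 hww')
  set K : Set (Fin 2 → ℂ × ℂ) := Set.pi Set.univ ![({w} : Set ℂ) ×ˢ Metric.closedBall w (‖w - w'‖ / 3),
      ({w'} : Set ℂ) ×ˢ Metric.closedBall w' (‖w - w'‖ / 3)] with hK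
  have hKc : IsCompact K := by
    refine isCompact_univ_pi (Fin.forall_fin_two.2 ⟨?_, ?_⟩)
    · simpa using isCompact_singleton.prod (isCompact_closedBall w (‖w - w'‖ / 3))
    · simpa using isCompact_singleton.prod (isCompact_closedBall w' (‖w - w'‖ / 3))
  have hKD : K ⊆ SixVertex.pairDomain 2 := pi_dipoles_subset_pairDomain hww'
  have hU := Metric.tendstoUniformlyOn_iff.1 (h1 K hKD hKc)
  -- for small `δ > 0` the dipole pair lies in `K`
  have hmem : ∀ᶠ δ : ℝ in 𝓝[>] 0, (![(w, w + δ * s), (w', w' + δ * s)] : Fin 2 → ℂ × ℂ) ∈ K := by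
    have hT : (0 : ℝ) < ‖w - w'‖ / (3 * (‖s‖ + 1)) := by positivity
    filter_upwards [Ioo_mem_nhdsGT hT] with δ hδ
    have hδs : ‖(δ : ℂ) * s‖ ≤ ‖w - w'‖ / 3 := by
      rw [norm_mul, Complex.norm_real, Real.norm_eq_abs, abs_of_pos hδ.1]
      have h4 : δ * (3 * (‖s‖ + 1)) < ‖w - w'‖ := (lt_div_iff₀ (by positivity)).1 hδ.2
      have h5 : 0 ≤ δ := hδ.1.le
      nlinarith [norm_nonneg s, mul_nonneg h5 (norm_nonneg s)]
    rw [hK, Set.mem_univ_pi, Fin.forall_fin_two]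
    refine ⟨?_, ?_⟩
    · simp only [Matrix.cons_val_zero, Set.mem_prod, Set.mem_singleton_iff, Metric.mem_closedBall,
        dist_eq_norm, add_sub_cancel_left, true_and]
      exact hδs
    · simp only [Matrix.cons_val_one, Matrix.cons_val_zero, Set.mem_prod, Set.mem_singleton_iff,
        Metric.mem_closedBall, dist_eq_norm, add_sub_cancel_left, true_and]
      exact hδs
  have hΨ : Tendsto (fun δ : ℝ ↦ C * SixVertex.gffKPoint 2 ![(w, w + δ * s), (w', w' + δ * s)])
      (𝓝[>] 0) (𝓝 0) := by
    have := (tendsto_gffKPoint_two_dipoles s hww').const_mul C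
    rw [mul_zero] at this
    exact tendsto_nhdsWithin_of_tendsto_nhds this
  rw [Metric.tendsto_nhds]
  intro ε hε
  have hΨ' := (Metric.tendsto_nhds.1 hΨ) (ε / 2) (half_pos hε)
  filter_upwards [hU (ε / 2) (half_pos hε), hmem, hΨ'] with δ hδU hδK hδΨ
  have h1' := hδU _ hδK
  rw [Real.dist_eq] at h1' hδΨ ⊢
  rw [sub_zero] at hδΨ ⊢
  calc |SixVertex.kPointScaled P₆ 2 δ ![(w, w + δ * s), (w', w' + δ * s)]|
      ≤ |C * SixVertex.gffKPoint 2 ![(w, w + δ * s), (w', w' + δ * s)] -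
          SixVertex.kPointScaled P₆ 2 δ ![(w, w + δ * s), (w', w' + δ * s)]| +
        |C * SixVertex.gffKPoint 2 ![(w, w + δ * s), (w', w' + δ * s)]| := by
        have h := abs_add_le
          (SixVertex.kPointScaled P₆ 2 δ ![(w, w + δ * s), (w', w' + δ * s)] -
            C * SixVertex.gffKPoint 2 ![(w, w + δ * s), (w', w' + δ * s)])
          (C * SixVertex.gffKPoint 2 ![(w, w + δ * s), (w', w' + δ * s)])
        rwa [sub_add_cancel, abs_sub_comm] at h
    _ < ε / 2 + ε / 2 := add_lt_add h1' hδΨ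
    _ = ε := add_halves ε

/-- The diagonal of `ℂ × ℂ` is Lebesgue-null. [folklore] -/
theorem volume_prod_diagonal_eq_zero :
    ((volume : Measure ℂ).prod (volume : Measure ℂ)) {p : ℂ × ℂ | p.1 = p.2} = 0 := by
  rw [Measure.prod_apply (measurableSet_eq_fun measurable_fst measurable_snd)]
  have : ∀ x : ℂ, (volume : Measure ℂ) (Prod.mk x ⁻¹' {p : ℂ × ℂ | p.1 = p.2}) = 0 := by
    intro x
    have hx : Prod.mk x ⁻¹' {p : ℂ × ℂ | p.1 = p.2} = {x} := by
      ext y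
      simp only [Set.mem_preimage, Set.mem_setOf_eq, Set.mem_singleton_iff]
      exact eq_comm
    rw [hx, measure_singleton]
  simp only [this, lintegral_zero]

/-- **The second moment of the shift error tends to zero** (`ρ` continuous, compactly supported):
dominated convergence on `ℂ × ℂ` — the increment correlations are bounded by
`(|re s|+|im s|+2)²` and tend to `0` off the (null) diagonal.
[cite: DKLM2026SixVertexGFF, Thm. 2.8 (1), k = 2] -/
theorem tendsto_integral_sq_shiftError (hP₆ : SixVertex.IsPlanarSixVertexMeasure a b c P₆) {C : ℝ}
    (h1 : ∀ K ⊆ SixVertex.pairDomain 2, IsCompact K →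
      TendstoUniformlyOn (fun δ u ↦ SixVertex.kPointScaled P₆ 2 δ u)
        (fun u ↦ C * SixVertex.gffKPoint 2 u) (𝓝[>] (0 : ℝ)) K)
    {ρ : ℂ → ℝ} (hρc : Continuous ρ) (hρs : HasCompactSupport ρ) (s : ℂ) :
    Tendsto (fun δ : ℝ ↦ ∫ ω, (∫ w, ((SixVertex.heightPlane ω (w / δ + s) : ℝ) -
        SixVertex.heightPlane ω (w / δ)) * ρ w) ^ 2 ∂P₆) (𝓝[>] 0) (𝓝 0) := by
  haveI : IsProbabilityMeasure P₆ := hP₆.1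
  have hρi : Integrable ρ := hρc.integrable_of_hasCompactSupport hρs
  simp_rw [integral_sq_integral_heightIncrement_mul hP₆ _ s hρc hρs]
  -- the correlation kernel
  set Kδ : ℝ → ℂ × ℂ → ℝ := fun δ p ↦ ∫ ω, ((SixVertex.heightPlane ω (p.1 / δ + s) : ℝ) -
      SixVertex.heightPlane ω (p.1 / δ)) * ((SixVertex.heightPlane ω (p.2 / δ + s) : ℝ) -
        SixVertex.heightPlane ω (p.2 / δ)) ∂P₆ with hKδ
  have hKm : ∀ δ, Measurable (Kδ δ) := by
    intro δ
    have hm : Measurable (Function.uncurry fun (p : ℂ × ℂ) (ω : SixVertex.Config (ℤ × ℤ)) ↦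
        ((SixVertex.heightPlane ω (p.1 / δ + s) : ℝ) - SixVertex.heightPlane ω (p.1 / δ)) *
          ((SixVertex.heightPlane ω (p.2 / δ + s) : ℝ) - SixVertex.heightPlane ω (p.2 / δ))) := by
      have hq1 : Measurable fun q : (ℂ × ℂ) × SixVertex.Config (ℤ × ℤ) ↦ (q.2, q.1.1) :=
        measurable_snd.prodMk (measurable_fst.comp measurable_fst)
      have hq2 : Measurable fun q : (ℂ × ℂ) × SixVertex.Config (ℤ × ℤ) ↦ (q.2, q.1.2) :=
        measurable_snd.prodMk (measurable_snd.comp measurable_fst)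
      have h1 := (measurable_heightIncrement δ s).comp hq1
      have h2 := (measurable_heightIncrement δ s).comp hq2
      exact h1.mul h2
    exact (hm.stronglyMeasurable.integral_prod_right (ν := P₆)).measurable
  have key : Tendsto (fun δ : ℝ ↦ ∫ p : ℂ × ℂ, Kδ δ p * (ρ p.1 * ρ p.2)
      ∂((volume : Measure ℂ).prod (volume : Measure ℂ))) (𝓝[>] 0)
      (𝓝 (∫ _p : ℂ × ℂ, (0 : ℝ) ∂((volume : Measure ℂ).prod (volume : Measure ℂ)))) := by
    refine tendsto_integral_filter_of_dominated_convergence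
      (fun p : ℂ × ℂ ↦ (|s.re| + |s.im| + 2) ^ 2 * (|ρ p.1| * |ρ p.2|)) ?_ ?_ ?_ ?_
    · exact Eventually.of_forall fun δ ↦
        (((hKm δ).mul ((hρc.measurable.comp measurable_fst).mul
          (hρc.measurable.comp measurable_snd))).aestronglyMeasurable)
    · refine Eventually.of_forall fun δ ↦ ae_of_all _ fun p ↦ ?_
      rw [Real.norm_eq_abs, abs_mul, abs_mul]
      exact mul_le_mul_of_nonneg_right
        (abs_integral_heightIncrement_mul_heightIncrement_le hP₆ δ s p.1 p.2) (by positivity)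
    · exact (hρi.abs.mul_prod hρi.abs).const_mul _
    · have hae : ∀ᵐ p : ℂ × ℂ ∂((volume : Measure ℂ).prod (volume : Measure ℂ)), p.1 ≠ p.2 := by
        rw [ae_iff]
        simpa using volume_prod_diagonal_eq_zero
      filter_upwards [hae] with p hp
      have ht := tendsto_kPointScaled_two_dipoles h1 s hp
      have heq : ∀ᶠ δ : ℝ in 𝓝[>] 0,
          SixVertex.kPointScaled P₆ 2 δ ![(p.1, p.1 + δ * s), (p.2, p.2 + δ * s)] = Kδ δ p := by
        filter_upwards [self_mem_nhdsWithin] with δ hδ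
        exact kPointScaled_two_dipoles P₆ hδ.ne' s p.1 p.2
      have := (ht.congr' heq).mul_const (ρ p.1 * ρ p.2)
      rwa [zero_mul] at this
  rw [integral_zero] at key
  exact key

end Limit

/-! ### The shift error tends to zero in probability; the shifted pairing has the same limit law -/

section InLaw

variable {a b c : ℝ} {P₆ : Measure (SixVertex.Config (ℤ × ℤ))}

/-- The shifted pairing `ω ↦ ⟨h^{(δ)}, ρ(· - δs)⟩` is measurable. [cite: DKLM2026SixVertexGFF, Def. 2.5] -/
theorem measurable_testPairing_shift (δ : ℝ) {ρ : ℂ → ℝ} (hρ : Measurable ρ) (s : ℂ) :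
    Measurable fun ω : SixVertex.Config (ℤ × ℤ) ↦
      SixVertex.testPairing ω δ (fun w ↦ ρ (w - δ * s)) :=
  measurable_testPairing δ (hρ.comp (measurable_id.sub_const ((δ : ℂ) * s)))

/-- **The shift error `⟨h^{(δ)}, ρ(· - δs)⟩ - ⟨h^{(δ)}, ρ⟩` tends to `0` in probability as
`δ → 0⁺`** (Markov's inequality on the second moment, `tendsto_integral_sq_shiftError`), for
every planar six-vertex measure whose scaled two-point functions converge to a multiple of
`Ψ₂^{GFF}` uniformly on compacts of `𝒟₂` and every continuous compactly supported `ρ`.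
[cite: DKLM2026SixVertexGFF, Thm. 2.8 (1), k = 2] -/
theorem tendstoInMeasure_shiftError (hP₆ : SixVertex.IsPlanarSixVertexMeasure a b c P₆) {C : ℝ}
    (h1 : ∀ K ⊆ SixVertex.pairDomain 2, IsCompact K →
      TendstoUniformlyOn (fun δ u ↦ SixVertex.kPointScaled P₆ 2 δ u)
        (fun u ↦ C * SixVertex.gffKPoint 2 u) (𝓝[>] (0 : ℝ)) K)
    {ρ : ℂ → ℝ} (hρc : Continuous ρ) (hρs : HasCompactSupport ρ) (s : ℂ) :
    TendstoInMeasure P₆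
      ((fun (δ : ℝ) (ω : SixVertex.Config (ℤ × ℤ)) ↦
          SixVertex.testPairing ω δ (fun w ↦ ρ (w - δ * s))) -
        fun (δ : ℝ) (ω : SixVertex.Config (ℤ × ℤ)) ↦ SixVertex.testPairing ω δ ρ)
      (𝓝[>] 0) 0 := by
  haveI : IsProbabilityMeasure P₆ := hP₆.1
  have hρi : Integrable ρ := hρc.integrable_of_hasCompactSupport hρs
  have h2 := tendsto_integral_sq_shiftError hP₆ h1 hρc hρs s
  rw [tendstoInMeasure_iff_norm]
  intro ε hε
  simp only [Pi.sub_apply, Pi.zero_apply, sub_zero]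
  have hmD : ∀ δ, Measurable fun ω : SixVertex.Config (ℤ × ℤ) ↦
      SixVertex.testPairing ω δ (fun w ↦ ρ (w - δ * s)) - SixVertex.testPairing ω δ ρ :=
    fun δ ↦ (measurable_testPairing_shift δ hρc.measurable s).sub (measurable_testPairing δ hρc.measurable)
  have hbound : ∀ᶠ δ : ℝ in 𝓝[>] 0,
      P₆ {ω | ε ≤ ‖SixVertex.testPairing ω δ (fun w ↦ ρ (w - δ * s)) - SixVertex.testPairing ω δ ρ‖} ≤
        ENNReal.ofReal ((∫ ω, (∫ w, ((SixVertex.heightPlane ω (w / δ + s) : ℝ) -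
          SixVertex.heightPlane ω (w / δ)) * ρ w) ^ 2 ∂P₆) / ε ^ 2) := by
    filter_upwards [self_mem_nhdsWithin] with δ hδ
    have hδ0 : δ ≠ 0 := hδ.ne'
    have hI : ∀ ω, SixVertex.testPairing ω δ (fun w ↦ ρ (w - δ * s)) - SixVertex.testPairing ω δ ρ =
        ∫ w, ((SixVertex.heightPlane ω (w / δ + s) : ℝ) - SixVertex.heightPlane ω (w / δ)) * ρ w :=
      fun ω ↦ testPairing_shift_sub ω hδ0 hρc hρs s
    -- integrability of the squared error (a.s. bounded)
    have hint : Integrable (fun ω ↦ (SixVertex.testPairing ω δ (fun w ↦ ρ (w - δ * s)) -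
        SixVertex.testPairing ω δ ρ) ^ 2) P₆ := by
      refine Integrable.of_bound ((hmD δ).pow_const 2).aestronglyMeasurable
        (((|s.re| + |s.im| + 2) * ∫ w, |ρ w|) ^ 2) ?_
      filter_upwards [hP₆.ae_iceRuleAt] with ω hω
      rw [Real.norm_eq_abs, abs_pow, hI ω]
      exact pow_le_pow_left₀ (abs_nonneg _) (abs_integral_heightIncrement_mul_le ω hω δ s hρi) 2
    have hmarkov := mul_meas_ge_le_integral_of_nonneg (ae_of_all _ fun ω ↦ sq_nonneg _) hint (ε ^ 2)
    have hsub : {ω | ε ≤ ‖SixVertex.testPairing ω δ (fun w ↦ ρ (w - δ * s)) - SixVertex.testPairing ω δ ρ‖} ⊆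
        {ω | ε ^ 2 ≤ (SixVertex.testPairing ω δ (fun w ↦ ρ (w - δ * s)) -
          SixVertex.testPairing ω δ ρ) ^ 2} := by
      intro ω hω
      simp only [Set.mem_setOf_eq, Real.norm_eq_abs] at hω ⊢
      calc ε ^ 2 ≤ |SixVertex.testPairing ω δ (fun w ↦ ρ (w - δ * s)) - SixVertex.testPairing ω δ ρ| ^ 2 :=
          pow_le_pow_left₀ hε.le hω 2
        _ = _ := sq_abs _
    have hfin : P₆ {ω | ε ^ 2 ≤ (SixVertex.testPairing ω δ (fun w ↦ ρ (w - δ * s)) -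
          SixVertex.testPairing ω δ ρ) ^ 2} ≠ ⊤ := measure_ne_top _ _
    calc _ ≤ P₆ {ω | ε ^ 2 ≤ (SixVertex.testPairing ω δ (fun w ↦ ρ (w - δ * s)) -
          SixVertex.testPairing ω δ ρ) ^ 2} := measure_mono hsub
      _ = ENNReal.ofReal (P₆.real {ω | ε ^ 2 ≤ (SixVertex.testPairing ω δ (fun w ↦ ρ (w - δ * s)) -
          SixVertex.testPairing ω δ ρ) ^ 2}) := by
          rw [measureReal_def, ENNReal.ofReal_toReal hfin]
      _ ≤ _ := by
          refine ENNReal.ofReal_le_ofReal ?_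
          rw [le_div_iff₀ (pow_pos hε 2), mul_comm]
          refine hmarkov.trans (le_of_eq ?_)
          refine integral_congr_ae (ae_of_all _ fun ω ↦ ?_)
          simp only [hI]
  have hlim : Tendsto (fun δ : ℝ ↦ ENNReal.ofReal ((∫ ω, (∫ w, ((SixVertex.heightPlane ω (w / δ + s) : ℝ) -
      SixVertex.heightPlane ω (w / δ)) * ρ w) ^ 2 ∂P₆) / ε ^ 2)) (𝓝[>] 0) (𝓝 0) := by
    have h := h2.div_const (ε ^ 2)
    rw [zero_div] at h
    have h' := ENNReal.tendsto_ofReal h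
    rwa [ENNReal.ofReal_zero] at h'
  exact tendsto_of_tendsto_of_tendsto_of_le_of_le' tendsto_const_nhds hlim
    (Eventually.of_forall fun _ ↦ zero_le) hbound

/-- Convergence of `∫ g(Y_i) dμ` for every bounded continuous `g` is convergence in distribution
(to the identity on `(ℝ, ν)`). [folklore] -/
theorem tendstoInDistribution_of_forall_integral_tendsto {Ω : Type*} [MeasurableSpace Ω]
    {μ : Measure Ω} [IsProbabilityMeasure μ] {ι : Type*} {l : Filter ι} {Y : ι → Ω → ℝ}
    (hY : ∀ i, AEMeasurable (Y i) μ) {ν : Measure ℝ} [IsProbabilityMeasure ν]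
    (h : ∀ g : ℝ →ᵇ ℝ, Tendsto (fun i ↦ ∫ ω, g (Y i ω) ∂μ) l (𝓝 (∫ x, g x ∂ν))) :
    TendstoInDistribution Y l id (fun _ ↦ μ) ν := by
  refine ⟨hY, aemeasurable_id, ?_⟩
  rw [ProbabilityMeasure.tendsto_iff_forall_integral_tendsto]
  intro g
  have h1 : ∀ i, ∫ x, g x ∂(μ.map (Y i)) = ∫ ω, g (Y i ω) ∂μ :=
    fun i ↦ integral_map (hY i) g.continuous.aestronglyMeasurable
  simp only [ProbabilityMeasure.coe_mk, Measure.map_id, h1]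
  exact h g

/-- Convergence in distribution (to the identity on `(ℝ, ν)`) gives convergence of `∫ g(Y_i) dμ`
for every bounded continuous `g`. [folklore] -/
theorem forall_integral_tendsto_of_tendstoInDistribution {Ω : Type*} [MeasurableSpace Ω]
    {μ : Measure Ω} [IsProbabilityMeasure μ] {ι : Type*} {l : Filter ι} {Y : ι → Ω → ℝ}
    {ν : Measure ℝ} [IsProbabilityMeasure ν] (h : TendstoInDistribution Y l id (fun _ ↦ μ) ν)
    (g : ℝ →ᵇ ℝ) :
    Tendsto (fun i ↦ ∫ ω, g (Y i ω) ∂μ) l (𝓝 (∫ x, g x ∂ν)) := by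
  have hY := h.forall_aemeasurable
  have ht := h.tendsto
  rw [ProbabilityMeasure.tendsto_iff_forall_integral_tendsto] at ht
  have h1 : ∀ i, ∫ x, g x ∂(μ.map (Y i)) = ∫ ω, g (Y i ω) ∂μ :=
    fun i ↦ integral_map (hY i) g.continuous.aestronglyMeasurable
  have := ht g
  simp only [ProbabilityMeasure.coe_mk, Measure.map_id, h1] at this
  exact this

/-- **Shift-robustness of the limit law of the test pairing.** Let `P₆` be a planar six-vertex
measure whose scaled two-point functions converge to `C · Ψ₂^{GFF}` uniformly on compacts of
`𝒟₂` (Thm. 2.8 (1), `k = 2`), and `ρ` a continuous compactly supported density such that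
`⟨h^{(δ)}, ρ⟩ → ν` in law (Thm. 2.8 (2)). Then for every lattice offset `s ∈ ℂ` the SHIFTED
pairings `⟨h^{(δ)}, ρ(· - δs)⟩` — the density translated by the vanishing, `δ`-proportional
vector `δs` — converge in law to the same `ν`: the shift error tends to `0` in probability
(`tendstoInMeasure_shiftError`) and Slutsky's lemma applies
(`MeasureTheory.tendstoInDistribution_of_tendstoInMeasure_sub`). This is what lets Thm. 2.8 (2),
stated for a FIXED `ρ`, be read through the Baxter–Kelland–Wu embedding of DKLM §3.2, whose
six-vertex lattice is the medial lattice `((1+i)/2)ℤ² + i/2` of the random-cluster lattice — a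
half-odd lattice offset that no automorphism of `ℤ²` removes.
[cite: DKLM2026SixVertexGFF, Thm. 2.8 (1)–(2); DuminilCopinKozlowskiLammersManolescu2026, §3.2] -/
theorem tendsto_integral_comp_testPairing_shift (hP₆ : SixVertex.IsPlanarSixVertexMeasure a b c P₆)
    {C : ℝ}
    (h1 : ∀ K ⊆ SixVertex.pairDomain 2, IsCompact K →
      TendstoUniformlyOn (fun δ u ↦ SixVertex.kPointScaled P₆ 2 δ u)
        (fun u ↦ C * SixVertex.gffKPoint 2 u) (𝓝[>] (0 : ℝ)) K)
    {ρ : ℂ → ℝ} (hρc : Continuous ρ) (hρs : HasCompactSupport ρ) {ν : Measure ℝ}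
    [IsProbabilityMeasure ν]
    (h2 : ∀ g : ℝ →ᵇ ℝ,
      Tendsto (fun δ ↦ ∫ ω, g (SixVertex.testPairing ω δ ρ) ∂P₆) (𝓝[>] (0 : ℝ)) (𝓝 (∫ x, g x ∂ν)))
    (s : ℂ) (g : ℝ →ᵇ ℝ) :
    Tendsto (fun δ ↦ ∫ ω, g (SixVertex.testPairing ω δ (fun w ↦ ρ (w - δ * s))) ∂P₆) (𝓝[>] (0 : ℝ))
      (𝓝 (∫ x, g x ∂ν)) := by
  haveI : IsProbabilityMeasure P₆ := hP₆.1
  have hD : TendstoInDistribution (fun (δ : ℝ) (ω : SixVertex.Config (ℤ × ℤ)) ↦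
      SixVertex.testPairing ω δ ρ) (𝓝[>] (0 : ℝ)) id (fun _ ↦ P₆) ν :=
    tendstoInDistribution_of_forall_integral_tendsto
      (fun δ ↦ (measurable_testPairing δ hρc.measurable).aemeasurable) h2
  have hM := tendstoInMeasure_shiftError hP₆ h1 hρc hρs s
  have hZ := tendstoInDistribution_of_tendstoInMeasure_sub (l := 𝓝[>] (0 : ℝ))
    (fun (δ : ℝ) (ω : SixVertex.Config (ℤ × ℤ)) ↦ SixVertex.testPairing ω δ (fun w ↦ ρ (w - δ * s)))
    id hD hM (fun δ ↦ (measurable_testPairing_shift δ hρc.measurable s).aemeasurable)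
  exact forall_integral_tendsto_of_tendstoInDistribution hZ g

/-- **Thm. 2.8 (2) for shifted densities.** Under the named fact
`SixVertex.DKLM2026_sixVertex_heightFunction_GFF`, for `√3 ≤ c ≤ 2`, every planar slope-zero
six-vertex measure `P₆` for the weights `(1,1,c)`, every continuous compactly supported zero-mean
`ρ` and every `s ∈ ℂ`: the law of `⟨h^{(δ)}, ρ(· - δs)⟩` converges weakly to
`N(0, (σ² ∬ G ρ ⊗ ρ)⁺)` as `δ → 0⁺`. [cite: DKLM2026SixVertexGFF, Thm. 2.8 (1)–(2)] -/
theorem tendsto_integral_comp_testPairing_shift_of_GFF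
    (hX : SixVertex.DKLM2026_sixVertex_heightFunction_GFF) (hc1 : Real.sqrt 3 ≤ c) (hc2 : c ≤ 2)
    (hP₆ : SixVertex.IsPlanarSixVertexMeasure 1 1 c P₆) {ρ : ℂ → ℝ} (hρc : Continuous ρ)
    (hρs : HasCompactSupport ρ) (hρ0 : ∫ z, ρ z = 0) (s : ℂ) (g : ℝ →ᵇ ℝ) :
    Tendsto (fun δ ↦ ∫ ω, g (SixVertex.testPairing ω δ (fun w ↦ ρ (w - δ * s))) ∂P₆) (𝓝[>] (0 : ℝ))
      (𝓝 (∫ x, g x ∂(gaussianReal 0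
        (Real.toNNReal (SixVertex.dklmSigma c ^ 2 * SixVertex.dirichletEnergy ρ))))) := by
  obtain ⟨hm1, hm2⟩ := hX c hc1 hc2 P₆ hP₆
  exact tendsto_integral_comp_testPairing_shift hP₆ (C := SixVertex.dklmSigma c ^ 2)
    (fun K hK hKc ↦ hm1 2 (by norm_num) K hK hKc) hρc hρs (hm2 ρ hρc hρs hρ0) s g

end InLaw

/-! ### Corollary 10 from Thm. 2.8 and the BKW identity with its lattice offset -/

/-- **Cor. 10 for one test function from the tree's Thm. 2.8 and the BKW identity read with its
half-lattice offset.** As `tendsto_integral_loopNestingWeight_of_sixVertexGFF`, but the BKW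
identity (DKLM (3.2)) is consumed in the form the Baxter–Kelland–Wu embedding actually delivers
it: `E_{P₆}[exp(i⟨h^{(δ)}, ρ(· - δs)⟩)] = E_P[∏_ℓ cos_μ(φ(int ℓ))]` for small `δ > 0`, with a
fixed lattice offset `s ∈ ℂ` (for the medial lattice of `δℤ²`, `s ∈ (ℤ + ½)²`; any `s` is
allowed here). [cite: DuminilCopinKozlowskiLammersManolescu2026, Cor. 10 (proof) and (3.2)] -/
theorem tendsto_integral_loopNestingWeight_of_sixVertexGFF_shift
    (hX : SixVertex.DKLM2026_sixVertex_heightFunction_GFF) {q : ℝ} (hq : q ∈ Set.Icc (1 : ℝ) 4)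
    (P : Measure (BondConfig (Site 2))) {φ : SignedMeasure ℂ} (hφ : IsGeneralisedTestFunction φ)
    (hE : HasFiniteDirichletEnergy φ) {P₆ : Measure (SixVertex.Config (ℤ × ℤ))}
    (hP₆ : SixVertex.IsPlanarSixVertexMeasure 1 1 (Real.sqrt (2 + Real.sqrt q)) P₆)
    {ρ : ℂ → ℝ} (hρc : Continuous ρ) (hρs : HasCompactSupport ρ) (hρ0 : ∫ z, ρ z = 0)
    (hρE : SixVertex.dirichletEnergy ρ = dirichletEnergy φ) (s : ℂ)
    (h32 : ∀ᶠ δ in 𝓝[>] 0,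
      ∫ ω, cexp (SixVertex.testPairing ω δ (fun w ↦ ρ (w - δ * s)) * I) ∂P₆ =
        ((∫ ω, loopNestingWeight q φ δ ω ∂P : ℝ) : ℂ)) :
    Tendsto (fun δ : ℝ ↦ ∫ ω, loopNestingWeight q φ δ ω ∂P) (𝓝[>] 0)
      (𝓝 (Real.exp (-(dklmSigmaSq q / 2) * dirichletEnergy φ))) := by
  set c := Real.sqrt (2 + Real.sqrt q) with hc
  haveI : IsProbabilityMeasure P₆ := hP₆.1
  have hg := tendsto_integral_comp_testPairing_shift_of_GFF hX (sqrt_three_le_sqrt_two_add_sqrt hq.1)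
    (sqrt_two_add_sqrt_le_two hq.2) hP₆ hρc hρs hρ0 s
  have hvar : SixVertex.dklmSigma c ^ 2 * SixVertex.dirichletEnergy ρ =
      dklmSigmaSq q * dirichletEnergy φ := by
    rw [hρE, ← dklmSigmaSq_eq_dklmSigma_sq hq.2]
  rw [hvar] at hg
  exact tendsto_integral_loopNestingWeight_of_gaussianLimit' hφ hE
    (fun δ ω ↦ SixVertex.testPairing ω δ (fun w ↦ ρ (w - δ * s)))
    (fun δ ↦ (measurable_testPairing_shift δ hρc.measurable s).aemeasurable) h32 hg

end Literature.Probability.Percolation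

end
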